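import Summits.HodgeConjecture.HodgeConjecture.Theorems.VHCAbelianSchemesRoadSecantQuotientHasMover
import Literature.AlgebraicGeometry.Motives.AbelianVarietyBlochFiltrationTransfer
import HarnessLib

/-!
# Road №4 (`VHCAbelianSchemesRoad`) — THE MOVER FAMILY FROM JUMP CONFINEMENT: stub (MM) of the lens line T
# (`Cruxes/DiagLocalOfMarkmanPinnedForall/TwistConfinedMoverFamily.lean` §2 `stub_moverFamily_of_confined`) PROVED, in unfolded form

research route conditional on HC_CM; not a corollary; Q11.4-sentence-2 already refuted in dim ≥ 3.

PROOFS ONLY (core-w5 gen 3, a width copy of seat core-D; helper `--supports stmt-HodgeConjecture-26512`; `HC_CM` nowhere; ZERO new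
named facts; nothing about any cell, stub of `birth.lean`, crux, carrier, `HC_AV` or HC is asserted). The lens line T re-cuts the research
stub (c4a) `PrintSheafHandleExists` of crux stmt-HodgeConjecture-26512 as (MM) ∧ (inj) ∧ (c4a-T); (MM) is its kernel-provable FIRST
LEMMA — refute-markman W9's steps (a)(c)(e) made abstract: PURE ABELIAN-VARIETY ARITHMETIC ON COMPLEX POINTS, no sheaf theory beyond the
predicate `OffDiagonalExtVanishing`. This file proves it with the three predicates of the Cruxes file (`MoverKernelJumpConfined`,
`InjOnMoverKernels`, `TorsionSparse`, and `OffDiagJump` inside the first) UNFOLDED to their bodies, so that it depends on `Theorems/`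
vocabulary only (`SecantQuotientDatum`, `D.P ∕ D.ψ ∕ D.Y ∕ D.q ∕ D.weilEndo ∕ D.IsMover`, `OffDiagonalExtVanishing`, `translationPullbackComplex`,
`AlgPoints.map`, Mathlib's `IsOfFinOrder`); the by-name form `MoverFamilyOfConfined` is the term
`fun D E _ lam B hB hinj hT ↦ SecantQuotientDatum.exists_bad_offDiagonalExtVanishing_of_isMover D E lam B hB hinj hT` once those
definitions live under `Theorems/` (core-w3 g2's `VHCAbelianSchemesRoadMoverTrapDefs`), by `δ`-unfolding alone.

* §1 Two arithmetic lemmas: from a TORSION-SPARSE subset `B` of a group (finitely many torsion elements `≠ 1`) a finite set of primes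
  `bad_B` such that every `b ∈ B ∖ 1` killed by a non-zero integer `N` has a prime of `bad_B` dividing `N`
  (`exists_primes_of_torsionSparse`); and `IsCoprime N (n : ℤ)` when no prime factor of `n` divides `N`.
* §2 Points arithmetic of the datum: `u ≫ ū = (m² + d) • 𝟙` for `u = m + φ_d`, `ū = 2m − u = m − φ_d` (`weilEndo_comp_coWeilEndo`,
  from `φ_d ≫ φ_d = −d`); `Ker q(ℂ) ⊆ (J × Ĵ)[d+1]` (`zpow_succ_eq_one_of_pointsMap_q_eq_one`: `Ker q(ℂ) = Ḡ` has exponent `d + 1`);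
  and THE KEY STEP `exists_torsion_mem_of_isMover`: for a mover `g = ḡ_u`, `gcd(m² + d, d + 1) = 1`, a point `x ∈ Ker g(ℂ) ∖ 1`,
  confinement of the `u`-kernel points over `x` into `B` through `λ` and injectivity of `λ` on `Ker u(ℂ)`, SOME `b ∈ B ∖ 1` has
  `b^{m²+d} = 1` — W9 §1 (a)(c): lift `x = q(ỹ)` (`q` is onto `ℂ`-points), `u ỹ ∈ Ker q(ℂ)` (as `q ≫ g = u ≫ q`), `Ker q(ℂ)` is a subgroup
  stable under `u` hence under `ū = 2m − u`, so `ỹ^{m²+d} = ū(u ỹ) ∈ Ker q(ℂ) ⊆ P[d+1]`: `x^{m²+d} = 1` and `ỹ^{(m²+d)(d+1)} = 1`; Bézout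
  `a(m²+d) + b(d+1) = 1` and `y := ỹ^{b(d+1)}` give `u y = 1`, `q y = x`, so `λ y ∈ B`, `λ y ≠ 1` (else `y = 1`, `x = 1`), `(λ y)^{m²+d} = 1`.
* §3 **(MM) `SecantQuotientDatum.exists_bad_offDiagonalExtVanishing_of_isMover`** (the statement of `stub_moverFamily_of_confined` with
  the three predicates unfolded): `bad := (d+1).primeFactors ∪ bad_B`; at a good `m` every prime of `d + 1` is excluded, so
  `gcd(m² + d, d + 1) = 1` and (inj)'s coprimality premise holds; a non-vanishing `Ext^k(τ_x^* E•, E•)` at `x ∈ Ker g(ℂ) ∖ 1` is a jump,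
  §2 yields `b ∈ B ∖ 1` with `b^{m²+d} = 1`, and §1 a bad prime dividing `m² + d` — contradiction (W9 §1 (e)).

Nothing here says (inj), (c4a-T), (c4a), any stub of `birth.lean`, 26512, 26511, №4, `HC_AV`, `HC_CM` or HC holds; HC_CM HELD, by name only.

References: [cite: Markman2025SecantWeil, §9.3 Lemma 9.3.3] [cite: MumfordAV1970, §7 Thm. 4 (p. 72)] [cite: Mukai1978, §3]
[cite: Raynaud1983SousVarietes, Théorème principal] [cite: MilneAV2008, I §8 Rem. 8.12 (p. 39)].
-/

noncomputable section

universe u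

open CategoryTheory CategoryTheory.Limits AlgebraicGeometry

namespace Summit.HodgeConjecture.HodgeConjecture.Ring2.SemiregularRepresentatives

set_option linter.dupNamespace false -- the cell's namespace repeats the summit name, as in every `Ring2*` file

open Literature.AlgebraicGeometry Literature.AlgebraicGeometry.Motives Literature.AlgebraicGeometry.Motives.AbelianVariety
open Literature.AlgebraicGeometry.HodgeTheory Literature.AlgebraicGeometry.Markman2025

/-! ## §1 Arithmetic: bad primes of a torsion-sparse set; coprimality off the prime factors -/

/-- **Bad primes of a torsion-sparse subset.** If only finitely many torsion elements `≠ 1` lie in `B`, there is a finite set of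
PRIMES (the prime factors of their orders) such that every `b ∈ B`, `b ≠ 1`, killed by a non-zero integer `N` has one of them
dividing `N` (W9 §1 (e): «`ord ∣ m² + d`, one of finitely many orders»). [cite: Markman2025SecantWeil, §9.3 Lemma 9.3.3]
[cite: Raynaud1983SousVarietes, Théorème principal] -/
theorem exists_primes_of_torsionSparse {G : Type*} [Group G] {B : Set G}
    (hT : {b : G | b ∈ B ∧ b ≠ 1 ∧ IsOfFinOrder b}.Finite) :
    ∃ bad : Finset ℕ, (∀ p ∈ bad, p.Prime) ∧
      ∀ b ∈ B, b ≠ 1 → ∀ N : ℤ, N ≠ 0 → b ^ N = 1 → ∃ p ∈ bad, (p : ℤ) ∣ N := by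
  classical
  refine ⟨hT.toFinset.biUnion fun b => (orderOf b).primeFactors, fun p hp => ?_, fun b hbB hb1 N hN hbN => ?_⟩
  · obtain ⟨b, -, hb⟩ := Finset.mem_biUnion.1 hp
    exact Nat.prime_of_mem_primeFactors hb
  · have hdvd : (orderOf b : ℤ) ∣ N := orderOf_dvd_iff_zpow_eq_one.2 hbN
    have hfin : IsOfFinOrder b := by
      rw [← orderOf_pos_iff, Nat.pos_iff_ne_zero]
      intro h0
      rw [h0, Nat.cast_zero, zero_dvd_iff] at hdvd
      exact hN hdvd
    have hne : orderOf b ≠ 1 := fun h => hb1 (orderOf_eq_one_iff.1 h)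
    obtain ⟨p, hp, hpb⟩ := Nat.exists_prime_and_dvd hne
    exact ⟨p, Finset.mem_biUnion.2 ⟨b, hT.mem_toFinset.2 ⟨hbB, hb1, hfin⟩,
      Nat.mem_primeFactors.2 ⟨hp, hpb, (orderOf_pos_iff.2 hfin).ne'⟩⟩, (Int.natCast_dvd_natCast.2 hpb).trans hdvd⟩

/-- **`gcd(N, n) = 1` when no prime factor of `n ≠ 0` divides `N`** (for `N = m² + d`, `n = d + 1` with every prime of `d + 1`
bad: W9 §1 (c) «order bookkeeping»). [cite: Markman2025SecantWeil, §9.3 Lemma 9.3.3] -/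
theorem isCoprime_of_forall_primeFactors_not_dvd {n : ℕ} (hn : n ≠ 0) {N : ℤ}
    (h : ∀ p ∈ n.primeFactors, ¬ ((p : ℤ) ∣ N)) : IsCoprime N (n : ℤ) := by
  rw [Int.isCoprime_iff_gcd_eq_one]
  show Nat.Coprime N.natAbs n
  exact Nat.Coprime.symm (Nat.coprime_of_dvd fun p hp hpn hpN =>
    h p (Nat.mem_primeFactors.2 ⟨hp, hpn, hn⟩) (Int.natCast_dvd.2 hpN))

/-! ## §2 Points arithmetic of a secant–quotient datum: `u ≫ ū = (m² + d) • 𝟙`, `Ker q(ℂ) ⊆ P[d+1]`, and the key step -/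

/-- On `L`-points, `(f ≫ g)(y) = g(f(y))`. [cite: GortzWedhorn2023, (27.35.1)] -/
theorem pointsMap_comp_apply {K : Type u} [Field K] {P Q R : AbelianVariety K} (L : Type u) [Field L] [Algebra K L]
    (f : P ⟶ Q) (g : Q ⟶ R) (y : P.Points L) : pointsMap L (f ≫ g) y = pointsMap L g (pointsMap L f y) := by
  rw [pointsMap_apply, pointsMap_apply, pointsMap_apply, AlgPoints.map_apply, AlgPoints.map_apply, AlgPoints.map_apply]
  exact (Category.assoc _ _ _).symm

/-- On `L`-points, `(n • 𝟙)(y) = y ^ n` for `n : ℤ`. [cite: GortzWedhorn2023, (27.35.1)] -/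
theorem pointsMap_zsmul_id {K : Type u} [Field K] {P : AbelianVariety K} (L : Type u) [Field L] [Algebra K L] (n : ℤ)
    (y : P.Points L) : pointsMap L (n • 𝟙 P) y = y ^ n := by
  rw [pointsMap_apply, AlgPoints.map_apply, comp_hom_zsmul]
  change (y ≫ 𝟙 _) ^ n = y ^ n
  rw [Category.comp_id]

/-- On `L`-points, `(f - f')(y) = f(y) · f'(y)⁻¹`. [cite: GortzWedhorn2023, (27.35.1)] -/
theorem pointsMap_sub {K : Type u} [Field K] {P Q : AbelianVariety K} (L : Type u) [Field L] [Algebra K L] (f f' : P ⟶ Q)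
    (y : P.Points L) : pointsMap L (f - f') y = pointsMap L f y * (pointsMap L f' y)⁻¹ := by
  rw [sub_eq_add_neg, pointsMap_apply, pointsMap_apply, pointsMap_apply, AlgPoints.map_apply, AlgPoints.map_apply,
    AlgPoints.map_apply, comp_hom_add', comp_hom_neg]

namespace SecantQuotientDatum

variable (D : SecantQuotientDatum)

/-- **`u ≫ ū = (m² + d) • 𝟙`** for `u = m + φ_d` and `ū := 2m − u = m − φ_d` (`Nm u = m² + d`: `φ_d ≫ φ_d = −d`).
[cite: Markman2025SecantWeil, §1.3 (η(k)) and §9.3 Lemma 9.3.3] [cite: vanGeemen1994HodgeAV, 4.9] -/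
theorem weilEndo_comp_coWeilEndo (m : ℤ) :
    D.weilEndo m ≫ ((2 * m) • 𝟙 D.P - D.weilEndo m) = (m ^ 2 + (D.d : ℤ)) • 𝟙 D.P := by
  simp only [weilEndo_def, Preadditive.comp_sub, Preadditive.add_comp, Preadditive.comp_add, Preadditive.zsmul_comp,
    Preadditive.comp_zsmul, Category.comp_id, Category.id_comp, D.ψ_comp_ψ]
  module

/-- On complex points: `ū(u(y)) = y^{m² + d}`. [cite: Markman2025SecantWeil, §9.3 Lemma 9.3.3] -/
theorem pointsMap_coWeilEndo_weilEndo (m : ℤ) (y : D.P.Points ℂ) :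
    pointsMap ℂ ((2 * m) • 𝟙 D.P - D.weilEndo m) (pointsMap ℂ (D.weilEndo m) y) = y ^ (m ^ 2 + (D.d : ℤ)) := by
  rw [← pointsMap_comp_apply, D.weilEndo_comp_coWeilEndo, pointsMap_zsmul_id]

/-- **`Ker q(ℂ) ⊆ (J × Ĵ)[d+1](ℂ)`**: a complex point killed by `q` lies in `Ḡ` (`Ker q(ℂ) = Ḡ`, Mumford §7 Thm. 4), which has
exponent `d + 1`. [cite: MumfordAV1970, §7 Thm. 4 (p. 72)] [cite: Markman2025SecantWeil, §9.3 (p. 72: G has exponent n = d+1)] -/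
theorem zpow_succ_eq_one_of_pointsMap_q_eq_one {h : D.P.Points ℂ} (hh : pointsMap ℂ D.q h = 1) :
    h ^ ((D.d + 1 : ℕ) : ℤ) = 1 := by
  have hker : h ∈ Hom.kerPoints (specOver ℂ ℂ) D.q := (Hom.mem_kerPoints_iff _ _).2 hh
  have hG : h ∈ rouquierImage D.𝒥.J D.isAmple D.G₁ D.G₂ :=
    ((D.𝒥.J.prod (D.𝒥.J.dualOf D.Θ D.isAmple)).mem_kerPoints_torsionQuotHom_iff D.succ_ne_zero _
      (rouquierImage_le_torsionPoints D.G₁_le D.G₂_le) h).1 hker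
  exact (mem_torsionPoints_iff _ _).1 (rouquierImage_le_torsionPoints D.G₁_le D.G₂_le hG)

/-- For a mover `g = ḡ_u`: `q(u(y)) = g(q(y))` on complex points. [cite: Markman2025SecantWeil, §1.5 (p. 7)] -/
theorem pointsMap_q_weilEndo {m : ℤ} {g : D.Y ⟶ D.Y} (hg : D.IsMover m g) (y : D.P.Points ℂ) :
    pointsMap ℂ D.q (pointsMap ℂ (D.weilEndo m) y) = pointsMap ℂ g (pointsMap ℂ D.q y) := by
  rw [← pointsMap_comp_apply, ← pointsMap_comp_apply, hg.q_comp]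

/-- For a mover `g = ḡ_u`: `Ker q(ℂ)` is stable under `ū = 2m − u` (it is a subgroup stable under `u`, as `q(u h) = g(q h)`).
[cite: Markman2025SecantWeil, §1.5 (p. 7) and §9.3 Lemma 9.3.3] -/
theorem pointsMap_q_coWeilEndo_eq_one {m : ℤ} {g : D.Y ⟶ D.Y} (hg : D.IsMover m g) {h : D.P.Points ℂ}
    (hh : pointsMap ℂ D.q h = 1) : pointsMap ℂ D.q (pointsMap ℂ ((2 * m) • 𝟙 D.P - D.weilEndo m) h) = 1 := by
  rw [pointsMap_sub, map_mul, map_inv, pointsMap_zsmul_id, map_zpow, hh, one_zpow, one_mul, inv_eq_one,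
    D.pointsMap_q_weilEndo hg, hh, map_one]

/-- **THE KEY STEP (W9 §1 (a)(c) abstract).** For a mover `g = ḡ_u` (`u = m + φ_d`) with `gcd(m² + d, d + 1) = 1`, a point
`x ∈ Ker g(ℂ)`, `x ≠ 1`, a homomorphism `λ : J × Ĵ → A′` INJECTIVE on `Ker u(ℂ)` and a set `B ⊆ A′(ℂ)` receiving `λ(y)` for every
`y ∈ Ker u(ℂ)` over `x`: some `b ∈ B`, `b ≠ 1`, satisfies `b^{m²+d} = 1`. Proof: `x = q(ỹ)`; `u ỹ ∈ Ker q(ℂ) ⊆ P[d+1]`;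
`ỹ^{m²+d} = ū(u ỹ) ∈ Ker q(ℂ)`, so `x^{m²+d} = 1` and `ỹ^{(m²+d)(d+1)} = 1`; with `a(m²+d) + b(d+1) = 1`, `y := ỹ^{b(d+1)}` has
`u y = 1`, `q y = x`; take `b := λ y`. [cite: Markman2025SecantWeil, §9.3 Lemma 9.3.3] [cite: MumfordAV1970, §7 Thm. 4 (p. 72)] -/
theorem exists_torsion_mem_of_isMover {m : ℤ} {g : D.Y ⟶ D.Y} (hg : D.IsMover m g)
    (hcop : IsCoprime (m ^ 2 + (D.d : ℤ)) ((D.d + 1 : ℕ) : ℤ)) {A' : AbelianVariety ℂ} (lam : D.P ⟶ A')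
    (B : Set (A'.Points ℂ)) {x : D.Y.Points ℂ} (hx : pointsMap ℂ g x = 1) (hx1 : x ≠ 1)
    (hconf : ∀ y : D.P.Points ℂ, pointsMap ℂ (D.weilEndo m) y = 1 → pointsMap ℂ D.q y = x → pointsMap ℂ lam y ∈ B)
    (hinj : ∀ y : D.P.Points ℂ, pointsMap ℂ (D.weilEndo m) y = 1 → pointsMap ℂ lam y = 1 → y = 1) :
    ∃ b ∈ B, b ≠ 1 ∧ b ^ (m ^ 2 + (D.d : ℤ)) = 1 := by
  obtain ⟨yt, hyt⟩ := pointsMap_surjective D.q D.isIsogeny_q.1 x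
  -- `u ỹ ∈ Ker q(ℂ)`, hence `(u ỹ)^{d+1} = 1`
  have hQu : pointsMap ℂ D.q (pointsMap ℂ (D.weilEndo m) yt) = 1 := by rw [D.pointsMap_q_weilEndo hg, hyt, hx]
  have h1 : (pointsMap ℂ (D.weilEndo m) yt) ^ ((D.d + 1 : ℕ) : ℤ) = 1 := D.zpow_succ_eq_one_of_pointsMap_q_eq_one hQu
  -- `ỹ^{m²+d} = ū(u ỹ) ∈ Ker q(ℂ)`
  have h2 : pointsMap ℂ D.q (yt ^ (m ^ 2 + (D.d : ℤ))) = 1 := by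
    rw [← D.pointsMap_coWeilEndo_weilEndo m yt]
    exact D.pointsMap_q_coWeilEndo_eq_one hg hQu
  have hxpow : x ^ (m ^ 2 + (D.d : ℤ)) = 1 := by rw [← hyt, ← map_zpow]; exact h2
  have h3 : (yt ^ (m ^ 2 + (D.d : ℤ))) ^ ((D.d + 1 : ℕ) : ℤ) = 1 := D.zpow_succ_eq_one_of_pointsMap_q_eq_one h2
  -- Bézout
  obtain ⟨a, b, hab⟩ := hcop
  set y : D.P.Points ℂ := yt ^ (b * ((D.d + 1 : ℕ) : ℤ)) with hy
  have hUy : pointsMap ℂ (D.weilEndo m) y = 1 := by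
    rw [hy, map_zpow, mul_comm, zpow_mul, h1, one_zpow]
  have hQy : pointsMap ℂ D.q y = x := by
    have hb : b * ((D.d + 1 : ℕ) : ℤ) = 1 - a * (m ^ 2 + (D.d : ℤ)) := by linear_combination hab
    rw [hy, map_zpow, hyt, hb, zpow_sub, zpow_one, mul_comm a, zpow_mul, hxpow, one_zpow, inv_one, mul_one]
  have hypow : y ^ (m ^ 2 + (D.d : ℤ)) = 1 := by
    rw [hy, ← zpow_mul, mul_comm (b * _), zpow_mul, mul_comm b, zpow_mul, h3, one_zpow]
  refine ⟨pointsMap ℂ lam y, hconf y hUy hQy, fun h => hx1 ?_, by rw [← map_zpow, hypow, map_one]⟩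
  rw [← hQy, hinj y hUy h, map_one]

/-! ## §3 (MM): the mover family from jump confinement -/

/-- **(MM) — THE MOVER FAMILY FROM JUMP CONFINEMENT** (the statement of the lens line T's `stub_moverFamily_of_confined` with its three
predicates `MoverKernelJumpConfined D E λ B`, `InjOnMoverKernels D λ`, `TorsionSparse B` — and `OffDiagJump` — UNFOLDED). If the
off-diagonal jumps of `E•` on the mover kernels are confined, through homomorphisms `λ_m : J × Ĵ → A′` injective on `Ker u_m(ℂ)` for
good `m`, to a subset `B ⊆ A′(ℂ)` with finitely many torsion points `≠ 1`, then there is a finite set `bad` of moduli `> 1` (the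
primes of `d + 1` and of the orders of those torsion points) such that EVERY mover `ḡ_{u_m}` with `m² + d` prime to `bad` satisfies
`(C^∨_{u_m})` for `E•`: `Ext^k(τ_x^* E•, E•) = 0` for all `x ∈ Ker ḡ_{u_m}(ℂ) ∖ 1` and all `k`. Proof = §2's key step + §1
(W9 §1 (a)(c)(e) made abstract; no sheaf theory is used). [cite: Markman2025SecantWeil, §9.3 Lemma 9.3.3]
[cite: MumfordAV1970, §7 Thm. 4 (p. 72)] [cite: Mukai1978, §3] [cite: Raynaud1983SousVarietes, Théorème principal] -/
theorem exists_bad_offDiagonalExtVanishing_of_isMover (E : CochainComplex D.Y.X.left.Modules ℤ) {A' : AbelianVariety ℂ}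
    (lam : ℤ → (D.P ⟶ A')) (B : Set (A'.Points ℂ))
    (hB : ∀ (m : ℤ) (y : D.P.Points ℂ),
      AlgPoints.map (D.weilEndo m).hom.hom.hom y = 1 →
        AlgPoints.map D.q.hom.hom.hom y ≠ 1 →
          (∃ k : ℤ,
            letI := HasDerivedCategory.standard D.Y.X.left.Modules
            Nontrivial (ShiftedHom (DerivedCategory.Q.obj (translationPullbackComplex D.Y (AlgPoints.map D.q.hom.hom.hom y) E))
              (DerivedCategory.Q.obj E) k)) →
            AlgPoints.map (lam m).hom.hom.hom y ∈ B)
    (hinj : ∀ m : ℤ, (∀ p ∈ (D.d + 1).primeFactors, ¬ ((p : ℤ) ∣ m ^ 2 + (D.d : ℤ))) →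
      ∀ y : D.P.Points ℂ, AlgPoints.map (D.weilEndo m).hom.hom.hom y = 1 → AlgPoints.map (lam m).hom.hom.hom y = 1 → y = 1)
    (hT : {b : A'.Points ℂ | b ∈ B ∧ b ≠ 1 ∧ IsOfFinOrder b}.Finite) :
    ∃ bad : Finset ℕ, (∀ N ∈ bad, 1 < N) ∧
      ∀ (m : ℤ) (g : D.Y ⟶ D.Y), D.IsMover m g → (∀ N ∈ bad, ¬ ((N : ℤ) ∣ m ^ 2 + (D.d : ℤ))) →
        OffDiagonalExtVanishing D.Y g E := by
  classical
  obtain ⟨badB, hprime, hbadB⟩ := exists_primes_of_torsionSparse hT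
  refine ⟨(D.d + 1).primeFactors ∪ badB, fun N hN => ?_, fun m g hg hgood => ?_⟩
  · rcases Finset.mem_union.1 hN with h | h
    · exact (Nat.prime_of_mem_primeFactors h).one_lt
    · exact (hprime N h).one_lt
  intro x hx hx1 k
  by_contra hns
  have hk := not_subsingleton_iff_nontrivial.1 hns
  have hgood₁ : ∀ p ∈ (D.d + 1).primeFactors, ¬ ((p : ℤ) ∣ m ^ 2 + (D.d : ℤ)) :=
    fun p hp => hgood p (Finset.mem_union_left _ hp)
  have hcop : IsCoprime (m ^ 2 + (D.d : ℤ)) ((D.d + 1 : ℕ) : ℤ) :=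
    isCoprime_of_forall_primeFactors_not_dvd D.succ_ne_zero hgood₁
  have hx' : pointsMap ℂ g x = 1 := (Hom.mem_kerPoints_iff _ _).1 hx
  obtain ⟨b, hbB, hb1, hbpow⟩ := D.exists_torsion_mem_of_isMover hg hcop (lam m) B hx' hx1
    (fun y hUy hQy => hB m y hUy (by rw [← pointsMap_apply, hQy]; exact hx1) (by
      have hQy' : AlgPoints.map D.q.hom.hom.hom y = x := hQy
      rw [hQy']
      exact ⟨k, hk⟩))
    (fun y hUy hLy => hinj m hgood₁ y hUy hLy)
  have hN : m ^ 2 + (D.d : ℤ) ≠ 0 := by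
    have h4 : (4 : ℤ) ≤ (D.d : ℤ) := by exact_mod_cast D.four_le
    nlinarith [sq_nonneg m]
  obtain ⟨p, hp, hpN⟩ := hbadB b hbB hb1 _ hN hbpow
  exact hgood p (Finset.mem_union_right _ hp) hpN

end SecantQuotientDatum

end Summit.HodgeConjecture.HodgeConjecture.Ring2.SemiregularRepresentatives

end
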